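import Mathlib
import HarnessLib
import Summits.HubbardSuperconductivity.HubbardSuperconductivity.Theorems.KLProgrammeH10TwoPointLimitIsoSymbolInstance

/-!
# Route `KLProgramme` — engine support, route (L2): the PACK of the padded ISOTROPIC multiplier on `(ℤ/4M) × (ℤ/L)²` — reality, sup,
# second differences in time and along the axes (packaged as `(2π/β)²c_G/Λ_m²` and `(2π/L)²κ₁/Λ_m²`), and the support count

Cell `gate-hubbard-kl`, seat p4 (C5a lead), g7; plan g13 GO «p4: type T̂_iso» (J2 of 3).  The five inputs `hreal`, `hF1`, `h₀`, `h₁`, `hsupp` of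
k3c2-p1's `torusSum_le_of_symbol_bounds` for `F = klIsoFamily … e₀ m` on an admissible frame, from the generic layer
(`norm_fwdDiff_two_time_sampledSymbol_le`, `norm_fwdDiff_two_space_sampledSymbol_le'`, `card_support_sampledSymbol_le`) fed with the
iso instance (`klIso_padded_eq_symbol`, `isoSymbol_zone_cell`, `isoSymbol_window4`, `abs_derivs_isoAngularFactor_line_le`):

* `conj_klIsoFamily`, `norm_klIsoFamily_le_one`;
* `norm_fwdDiff_two_time_isoPadded_le` — `≤ (4de₀⁴ + 2de₀²)(2π/β)²·1/Λ_m²`;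
* `kx1_le` (pure reals) and **`norm_fwdDiff_two_axis_isoPadded_le`** — `≤ (2π/L)²·κ₁/Λ_m²`,
  `κ₁ = (4de₀⁴+2de₀²)Y² + 2de₀²(4+4A)e₀ + 16de₀²B_aYe₀ + 8B_ae₀²`, `Y = (4+2A) + (4+4A)(r̄e₀ + 1)`, `r̄ = (1 + 3πs_maxDt_min/(4e₀))/(Dt_min−2A)`
  (the iso cell radius is `r̄Λ_m`; the angular factor costs `(1+2/w_{2m})Λ_m ≤ 2e₀` — no tangent step is needed);
* **`card_support_isoPadded_le`** — `#{≠ 0} ≤ (Λ_mβ/π + 1)·(√2L(Λ_m + (4+4A)(r̄Λ_m)²)/(γπ) + 2)(2√2Lr̄Λ_m/π + 2)`, `γ = 2ρ_min − 4A`.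

Everything is proved; no definitions, no named facts. [cite: BenfattoGiulianiMastropietro2006, §2.5 Lemma 2.2, (2.57), §2.6 (2.81)]
-/

noncomputable section

namespace Summit.HubbardSuperconductivity.HubbardSuperconductivity.Theorems.TorusFourierL2

set_option linter.dupNamespace false -- summit = problem name (single-conjunct summit), D-0017

open Set Finset Literature.MathematicalPhysics.QuantumLattice Literature.MathematicalPhysics.QuantumLattice.BandSectorCounting
open Literature.MathematicalPhysics.QuantumLattice.FermiRG Literature.Probability.LatticeModels Literature.Analysis.SpecialFunctions
open Summit.HubbardSuperconductivity.HubbardSuperconductivity.Theorems.DispersionFlow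
open Summit.HubbardSuperconductivity.HubbardSuperconductivity.Theorems.KLRegimeSplit
open Summit.HubbardSuperconductivity.HubbardSuperconductivity.Theorems.KLProgrammeLegKernels
open Summit.HubbardSuperconductivity.HubbardSuperconductivity.Theorems.PerturbedFermiCurve
open scoped Real ComplexConjugate

/-! ### §1 Reality and sup of the isotropic family -/

/-- The isotropic multipliers are real. [folklore] -/
theorem conj_klIsoFamily {L M : ℕ} [NeZero L] (β μ : ℝ) (K : TrigPolyC4v) (e₀ : ℝ) (m : ℕ) (ω : Fin (sectorCount (2 * m)))
    (k : FreqMomentum L M) : conj (klIsoFamily L M β μ K e₀ m ω k) = klIsoFamily L M β μ K e₀ m ω k := by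
  unfold klIsoFamily klIsoMultiplier
  exact Complex.conj_ofReal _

/-- The isotropic multipliers have modulus `≤ 1`. [folklore] -/
theorem norm_klIsoFamily_le_one {L M : ℕ} [NeZero L] (β μ : ℝ) (K : TrigPolyC4v) (e₀ : ℝ) (m : ℕ) (ω : Fin (sectorCount (2 * m)))
    (k : FreqMomentum L M) : ‖klIsoFamily L M β μ K e₀ m ω k‖ ≤ 1 := by
  unfold klIsoFamily klIsoMultiplier
  rw [Complex.norm_real, Real.norm_eq_abs]
  have h1 := gnScaleCutoff_mem_Icc 4 e₀ (-(m : ℤ)) (Real.sqrt (matsubaraFreq β M k.1 ^ 2 + nambuXiCT L μ K k.2 ^ 2))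
  have h2 : 0 ≤ sectorWeightCirc (2 * m) ((ω : ℕ) : ℤ) (momentumAngle L k.2) ∧
      sectorWeightCirc (2 * m) ((ω : ℕ) : ℤ) (momentumAngle L k.2) ≤ 1 := ⟨sectorWeightCirc_nonneg _ _ _, sectorWeightCirc_le_one _ _ _⟩
  rw [abs_of_nonneg (mul_nonneg h1.1 h2.1)]
  exact mul_le_one₀ h1.2 h2.1 h2.2

/-! ### §2 The packaging of the axis constant (pure reals) -/

/-- **Packaging of the single-factor axis constant**: with `τ' = τ + K₂(ρ + 2h)h ≤ hY`, `ρ ≤ r`, `2h ≤ 1`, `D_cΛ ≤ 2e₀h`, `Λ ≤ e₀`: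
`(c_Gτ'²/Λ² + 2g₁(K₂h²)/Λ)·1 + 4g₁τ'/Λ·(2BaD_c) + 1·(2BaD_c²) ≤ (h²/Λ²)(c_GY² + 2g₁K₂e₀ + 16g₁BaYe₀ + 8Bae₀²)`. [folklore] -/
theorem kx1_le {cG g1 Ba K₂ Λ e₀ ρ τ h Dc Y : ℝ} (hcG : 0 ≤ cG) (hg1 : 0 ≤ g1) (hBa : 0 ≤ Ba) (hK : 0 ≤ K₂) (hΛ : 0 < Λ) (hΛe : Λ ≤ e₀)
    (hρ : 0 ≤ ρ) (hτ : 0 ≤ τ) (hh : 0 ≤ h) (hDc : 0 ≤ Dc) (hY : 0 ≤ Y) (hτY : τ + K₂ * (ρ + 2 * h) * h ≤ h * Y)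
    (hDcΛ : Dc * Λ ≤ 2 * e₀ * h) :
    (cG * (τ + K₂ * (ρ + 2 * h) * h) ^ 2 / Λ ^ 2 + 2 * g1 * (K₂ * h ^ 2) / Λ) * 1 +
        4 * g1 * (τ + K₂ * (ρ + 2 * h) * h) / Λ * (2 * Ba * Dc) + 1 * (2 * Ba * Dc ^ 2) ≤
      h ^ 2 / Λ ^ 2 * (cG * Y ^ 2 + 2 * g1 * K₂ * e₀ + 16 * g1 * Ba * Y * e₀ + 8 * Ba * e₀ ^ 2) := by
  have hΛ2 : 0 < Λ ^ 2 := by positivity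
  have hT0 : 0 ≤ τ + K₂ * (ρ + 2 * h) * h := by positivity
  have he0 : 0 ≤ e₀ := hΛ.le.trans hΛe
  have hA' : cG * (τ + K₂ * (ρ + 2 * h) * h) ^ 2 / Λ ^ 2 ≤ h ^ 2 / Λ ^ 2 * (cG * Y ^ 2) := by
    have h1 : (τ + K₂ * (ρ + 2 * h) * h) ^ 2 ≤ (h * Y) ^ 2 := pow_le_pow_left₀ hT0 hτY 2
    calc _ ≤ cG * (h * Y) ^ 2 / Λ ^ 2 := by gcongr
      _ = h ^ 2 / Λ ^ 2 * (cG * Y ^ 2) := by ring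
  have hB' : 2 * g1 * (K₂ * h ^ 2) / Λ ≤ h ^ 2 / Λ ^ 2 * (2 * g1 * K₂ * e₀) := by
    have e1 : 2 * g1 * (K₂ * h ^ 2) / Λ = 2 * g1 * K₂ * h ^ 2 * Λ / Λ ^ 2 := by field_simp
    calc _ = 2 * g1 * K₂ * h ^ 2 * Λ / Λ ^ 2 := e1
      _ ≤ 2 * g1 * K₂ * h ^ 2 * e₀ / Λ ^ 2 := by gcongr
      _ = h ^ 2 / Λ ^ 2 * (2 * g1 * K₂ * e₀) := by ring
  have hC' : 4 * g1 * (τ + K₂ * (ρ + 2 * h) * h) / Λ * (2 * Ba * Dc) ≤ h ^ 2 / Λ ^ 2 * (16 * g1 * Ba * Y * e₀) := by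
    have e1 : 4 * g1 * (τ + K₂ * (ρ + 2 * h) * h) / Λ * (2 * Ba * Dc) = 8 * g1 * Ba * ((τ + K₂ * (ρ + 2 * h) * h) * (Dc * Λ)) / Λ ^ 2 := by
      field_simp
      ring
    have h1 : (τ + K₂ * (ρ + 2 * h) * h) * (Dc * Λ) ≤ (h * Y) * (2 * e₀ * h) := mul_le_mul hτY hDcΛ (by positivity) (by positivity)
    calc _ = 8 * g1 * Ba * ((τ + K₂ * (ρ + 2 * h) * h) * (Dc * Λ)) / Λ ^ 2 := e1
      _ ≤ 8 * g1 * Ba * ((h * Y) * (2 * e₀ * h)) / Λ ^ 2 := by gcongr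
      _ = h ^ 2 / Λ ^ 2 * (16 * g1 * Ba * Y * e₀) := by ring
  have hD' : 1 * (2 * Ba * Dc ^ 2) ≤ h ^ 2 / Λ ^ 2 * (8 * Ba * e₀ ^ 2) := by
    have e1 : 1 * (2 * Ba * Dc ^ 2) = 2 * Ba * (Dc * Λ) ^ 2 / Λ ^ 2 := by field_simp
    have h1 : (Dc * Λ) ^ 2 ≤ (2 * e₀ * h) ^ 2 := pow_le_pow_left₀ (by positivity) hDcΛ 2
    calc _ = 2 * Ba * (Dc * Λ) ^ 2 / Λ ^ 2 := e1
      _ ≤ 2 * Ba * (2 * e₀ * h) ^ 2 / Λ ^ 2 := by gcongr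
      _ = h ^ 2 / Λ ^ 2 * (8 * Ba * e₀ ^ 2) := by ring
  have e : h ^ 2 / Λ ^ 2 * (cG * Y ^ 2 + 2 * g1 * K₂ * e₀ + 16 * g1 * Ba * Y * e₀ + 8 * Ba * e₀ ^ 2) =
      h ^ 2 / Λ ^ 2 * (cG * Y ^ 2) + h ^ 2 / Λ ^ 2 * (2 * g1 * K₂ * e₀) + h ^ 2 / Λ ^ 2 * (16 * g1 * Ba * Y * e₀) +
        h ^ 2 / Λ ^ 2 * (8 * Ba * e₀ ^ 2) := by ring
  have e' : (cG * (τ + K₂ * (ρ + 2 * h) * h) ^ 2 / Λ ^ 2 + 2 * g1 * (K₂ * h ^ 2) / Λ) * 1 +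
        4 * g1 * (τ + K₂ * (ρ + 2 * h) * h) / Λ * (2 * Ba * Dc) + 1 * (2 * Ba * Dc ^ 2) =
      cG * (τ + K₂ * (ρ + 2 * h) * h) ^ 2 / Λ ^ 2 + 2 * g1 * (K₂ * h ^ 2) / Λ +
        4 * g1 * (τ + K₂ * (ρ + 2 * h) * h) / Λ * (2 * Ba * Dc) + 1 * (2 * Ba * Dc ^ 2) := by ring
  rw [e, e']
  linarith

/-! ### §3 The pointwise bounds and the support count of the padded isotropic multiplier -/

section Pack

variable {L M : ℕ} [NeZero L] [NeZero M] {a b : ℝ} (B : BandBounds a b) {K : TrigPolyC4v} {A : ℝ}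
  (hA : ∀ p : Momentum, ∀ j ≤ 2, ‖iteratedFDeriv ℝ j (frameShift K) p‖ ≤ A) (hADt : 2 * A < B.Dtmin)
  {μ e₀ z β : ℝ} (he : 0 < e₀) (hz : 0 < z) (hz1 : z ≤ 1) (hgap : e₀ + A + z ^ 2 < -μ) (h3 : e₀ + A - μ ≤ 3)
  (hlo : a ≤ μ - A - e₀) (hhi : μ + A + e₀ ≤ b) (hβ : 0 < β) (hρA : 4 * A < 2 * B.rhomin)
  {m : ℕ} (ω : Fin (sectorCount (2 * m)))
  {d : ℝ} (hd : 0 ≤ d) (hd1 : ∀ u, |deriv (bgmCutoffSq e₀) u| ≤ d) (hd2 : ∀ u, |iteratedDeriv 2 (bgmCutoffSq e₀) u| ≤ d)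
  {Z : (Fin 2 → ℝ) → ℝ}
  (hZ : ∀ p, Z p = gnCutoff ((π + z) ^ 2 / π ^ 2) ((π + z) ^ 2) (p 0 ^ 2) * gnCutoff ((π + z) ^ 2 / π ^ 2) ((π + z) ^ 2) (p 1 ^ 2) *
    (radialCutoffC (1 / 2) (momToComplex p) * sectorWeightCirc (2 * m) ((ω : ℕ) : ℤ) (polarAngle p)))
  {Φ : ℝ × (Fin 2 → ℝ) → ℂ}
  (hΦ : ∀ k₀ p, Φ (k₀, p) = ((bgmCutoffSq e₀ ((16 : ℝ) ^ m * (k₀ ^ 2 + frameLevel μ K (WithLp.toLp 2 p) ^ 2)) * Z p : ℝ) : ℂ))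
  {Gs : TorusSite 1 (2 * (2 * M)) × TorusSite 2 L → ℂ}
  (hGs : ∀ q, Gs q = if h : (q.1 0).val < 2 * M then klIsoFamily L M β μ K e₀ m ω (⟨(q.1 0).val, h⟩, q.2) else 0)

include hA h3 he hz hβ hd hd1 hd2 hZ hΦ hGs in
/-- **Time direction**: `‖Δ²_{(1,0)} G̃(q)‖ ≤ (4de₀⁴ + 2de₀²)(2π/β)²·1/Λ_m²` for every `q`, provided `Λ_mβ < π(2M − 3)`.
[cite: BenfattoGiulianiMastropietro2006, §2.5 Lemma 2.2 (2.52)] -/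
theorem norm_fwdDiff_two_time_isoPadded_le (hM : klScale e₀ m * β < π * (2 * M - 3)) (hM1 : 1 ≤ M)
    (q : TorusSite 1 (2 * (2 * M)) × TorusSite 2 L) :
    ‖((fwdDiff ((fun _ : Fin 1 => (1 : ZMod (2 * (2 * M)))), (0 : TorusSite 2 L)))^[2] Gs) q‖ ≤
      (4 * (d * e₀ ^ 4) + 2 * (d * e₀ ^ 2)) * (2 * π / β) ^ 2 * 1 / klScale e₀ m ^ 2 := by
  haveI : NeZero (2 * (2 * M)) := ⟨by have := NeZero.ne M; omega⟩
  obtain ⟨hGc, -, hG1, hG2, hGv⟩ := scaleProfile_bounds he m hd1 hd2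
  have hΛ : 0 < klScale e₀ m := by rw [klScale]; positivity
  exact norm_fwdDiff_two_time_sampledSymbol_le hGc hΛ (by positivity) (by positivity) hG1 hG2 hGv
    (fun p : Fin 2 → ℝ => frameLevel μ K (WithLp.toLp 2 p)) Z (isoAngularFactor_props hZ hz).2.1 Φ (fun k₀ p => hΦ k₀ p)
    (π * (1 - 2 * M) / β) (2 * π / β) (2 * π / L) (fun mm hmm => isoSymbol_window4 hβ hM hM1 mm hmm) Gs
    (klIso_padded_eq_symbol hA he hz h3 hβ ω hZ hΦ hGs hM) q

include B hA hADt he hz hz1 hgap h3 hlo hhi hβ hd hd1 hd2 hZ hΦ hGs in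
/-- **Axis directions**: for `i = 0, 1` and every `q`, `‖Δ²_{(0,eᵢ)} G̃(q)‖ ≤ (2π/L)²·κ₁/Λ_m²` (see the module docstring for `κ₁`), provided
`Λ_mβ < π(2M−3)` and `2|2π/L| ≤ z`. [cite: BenfattoGiulianiMastropietro2006, §2.5 Lemma 2.2 (2.53)–(2.55)] -/
theorem norm_fwdDiff_two_axis_isoPadded_le {Ba : ℝ} (hB0 : 0 ≤ Ba)
    (hB : ∀ (i : ℕ), i ≤ 2 → ∀ (n : ℕ) (ω : ℤ) (θ₀ : ℝ) (q w : Fin 2 → ℝ) (t : ℝ) {r₀ : ℝ}, 0 < r₀ →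
      r₀ ≤ ‖momToComplex (q + t • w)‖ → |sectorRelAngle θ₀ (q + t • w)| < π →
      ‖iteratedDeriv i (fun t : ℝ => sectorWeightCirc n ω (polarAngle (q + t • w))) t‖ ≤
        (2 : ℕ).factorial * Ba * ((1 + (sectorWidth n)⁻¹ * (2 : ℕ).factorial) * ‖momToComplex w‖ / r₀) ^ i)
    (hM : klScale e₀ m * β < π * (2 * M - 3)) (hLz : 2 * |2 * π / (L : ℝ)| * 1 ≤ z)
    (q : TorusSite 1 (2 * (2 * M)) × TorusSite 2 L) (i : Fin 2) :
    ‖((fwdDiff ((0 : TorusSite 1 (2 * (2 * M))), (Pi.single i (1 : ZMod L) : TorusSite 2 L)))^[2] Gs) q‖ ≤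
      (2 * π / L) ^ 2 / klScale e₀ m ^ 2 * ((4 * (d * e₀ ^ 4) + 2 * (d * e₀ ^ 2)) *
        ((4 + 2 * A) + (4 + 4 * A) * ((1 + 3 * π * B.smax * B.Dtmin / (4 * e₀)) / (B.Dtmin - 2 * A) * e₀ + 1)) ^ 2 +
        2 * (d * e₀ ^ 2) * (4 + 4 * A) * e₀ +
        16 * (d * e₀ ^ 2) * Ba * ((4 + 2 * A) + (4 + 4 * A) * ((1 + 3 * π * B.smax * B.Dtmin / (4 * e₀)) / (B.Dtmin - 2 * A) * e₀ + 1)) * e₀ +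
        8 * Ba * e₀ ^ 2) := by
  haveI : NeZero (2 * (2 * M)) := ⟨by have := NeZero.ne M; omega⟩
  obtain ⟨hGc, hG0, hG1, hG2, hGv⟩ := scaleProfile_bounds he m hd1 hd2
  obtain ⟨hZc, hZ0, -, -⟩ := isoAngularFactor_props hZ hz
  obtain ⟨hzoneΦ, hcell⟩ := isoSymbol_zone_cell B hA hADt he hz hz1 hgap hlo hhi ω hZ hΦ
  have hΛ : 0 < klScale e₀ m := by rw [klScale]; positivity
  have hΛe : klScale e₀ m ≤ e₀ := klScale_le_e0 he.le m
  have hL : (0 : ℝ) < L := Nat.cast_pos.2 (Nat.pos_of_ne_zero (NeZero.ne L))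
  have hπ := Real.pi_pos
  have hc : 0 < 2 * π / (L : ℝ) := by positivity
  have hA0 : 0 ≤ A := le_trans (norm_nonneg _) (hA 0 0 (by norm_num))
  have hDt : 0 < B.Dtmin - 2 * A := by linarith
  set Λ : ℝ := klScale e₀ m with hΛdef
  set ρ : ℝ := (klScale e₀ m + B.smax * B.Dtmin * (3 * sectorWidth (2 * m) / 4)) / (B.Dtmin - 2 * A) with hρdef
  have hρ0 : 0 ≤ ρ := by have := B.smax_pos; have := B.Dtmin_pos; have := sectorWidth_pos (2 * m); positivity
  set w : Fin 2 → ℝ := fun j => 2 * π / L * (((Pi.single i (1 : ℤ) : Fin 2 → ℤ) j : ℤ) : ℝ) with hw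
  have hwn : ‖w‖ = 2 * π / L ∧ ‖momToComplex w‖ = 2 * π / L := norms_axisStep L i
  -- points of the enlarged square in the shell are in the open square and in the Fermi region
  have hinner : ∀ p : Fin 2 → ℝ, (∀ i, |p i| ≤ π + z) → |frameLevel μ K (WithLp.toLp 2 p)| ≤ Λ →
      (∀ i, |p i| < π) ∧ 1 ≤ ‖momToComplex p‖ := by
    intro p hsq hshell
    refine ⟨fun j => ?_, one_le_norm_of_frameBand_le hA h3 (hshell.trans hΛe)⟩
    by_contra hge
    push Not at hge
    have h1 : π - z ≤ |p j| := by linarith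
    have := frameBand_zone hA hz1 hgap h1 (hsq j)
    exact absurd (hshell.trans hΛe) (not_le.2 this)
  have hZ1 : ∀ (p₀ : Fin 2 → ℝ) (s : ℝ), (∀ i, |(p₀ + s • w) i| ≤ π + z) → |frameLevel μ K (WithLp.toLp 2 (p₀ + s • w))| ≤ Λ →
      |deriv (fun s : ℝ => Z (p₀ + s • w)) s| ≤ 2 * Ba * ((1 + 2 * (sectorWidth (2 * m))⁻¹) * ‖momToComplex w‖) := by
    intro p₀ s hsq hshell
    obtain ⟨hin, hfermi⟩ := hinner _ hsq hshell
    exact (abs_derivs_isoAngularFactor_line_le hZ hz hB p₀ w hin hfermi).1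
  have hZ2 : ∀ (p₀ : Fin 2 → ℝ) (s : ℝ), (∀ i, |(p₀ + s • w) i| ≤ π + z) → |frameLevel μ K (WithLp.toLp 2 (p₀ + s • w))| ≤ Λ →
      |iteratedDeriv 2 (fun s : ℝ => Z (p₀ + s • w)) s| ≤ 2 * Ba * ((1 + 2 * (sectorWidth (2 * m))⁻¹) * ‖momToComplex w‖) ^ 2 := by
    intro p₀ s hsq hshell
    obtain ⟨hin, hfermi⟩ := hinner _ hsq hshell
    exact (abs_derivs_isoAngularFactor_line_le hZ hz hB p₀ w hin hfermi).2
  have hτ : |fderiv ℝ (fun p : Fin 2 → ℝ => frameLevel μ K (WithLp.toLp 2 p)) (klFermiPoint μ K (sectorCenter (2 * m) (ω : ℕ))) w|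
      ≤ (4 + 2 * A) * (2 * π / L) := by
    calc _ ≤ (4 + 2 * A) * ‖w‖ := abs_fderiv_frameBand_apply_le hA μ _ _
      _ = (4 + 2 * A) * (2 * π / L) := by rw [hwn.1]
  have hu : ∀ j, 2 * |2 * π / (L : ℝ)| * |(((Pi.single i (1 : ℤ) : Fin 2 → ℤ) j : ℤ) : ℝ)| ≤ z := by
    intro j
    have h1 : |(((Pi.single i (1 : ℤ) : Fin 2 → ℤ) j : ℤ) : ℝ)| ≤ 1 := by
      by_cases hj : j = i
      · subst hj; simp
      · simp [hj]
    exact (mul_le_mul_of_nonneg_left h1 (by positivity)).trans hLz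
  have hxL : |2 * π / (L : ℝ)| * L = 2 * π := by rw [abs_of_pos hc]; field_simp
  have hz1' : 0 ≤ 2 * Ba * ((1 + 2 * (sectorWidth (2 * m))⁻¹) * ‖momToComplex w‖) := by
    have := sectorWidth_pos (2 * m); positivity
  have hraw := norm_fwdDiff_two_space_sampledSymbol_le' hGc hΛ zero_le_one (by positivity) (by positivity) hG0 hG1 hG2 hGv
    (contDiff_frameBand μ K) (norm_iteratedFDeriv_two_frameBand_le hA μ) hZc zero_le_one hz1' (by positivity) hZ0 w hZ1 hZ2 hρ0 hτ
    (fun p hsq hshell hZp => hcell p hsq hshell hZp) Φ (fun k₀ p => hΦ k₀ p) (π * (1 - 2 * M) / β) (2 * π / β) (2 * π / L)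
    (Pi.single i 1) rfl hu hzoneΦ hxL Gs (klIso_padded_eq_symbol hA he hz h3 hβ ω hZ hΦ hGs hM) q
  rw [axisStep_cast] at hraw
  rw [hwn.1, hwn.2] at hraw
  refine hraw.trans ?_
  -- the packaging
  have hw2m : sectorWidth (2 * m) = π * klScale e₀ m / e₀ := by
    rw [sectorWidth, klScale, pow_mul]; field_simp; norm_num
  have hρr : ρ ≤ (1 + 3 * π * B.smax * B.Dtmin / (4 * e₀)) / (B.Dtmin - 2 * A) * e₀ := by
    rw [hρdef, hw2m, div_mul_eq_mul_div, div_le_div_iff_of_pos_right hDt]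
    have hsm := B.smax_pos; have hDm := B.Dtmin_pos
    have h1 : B.smax * B.Dtmin * (3 * (π * klScale e₀ m / e₀) / 4) ≤ B.smax * B.Dtmin * (3 * (π * e₀ / e₀) / 4) := by gcongr
    have h2 : 3 * (π * e₀ / e₀) / 4 = 3 * π / 4 := by field_simp
    rw [h2] at h1
    have e3 : (1 + 3 * π * B.smax * B.Dtmin / (4 * e₀)) * e₀ = e₀ + B.smax * B.Dtmin * (3 * π / 4) := by field_simp
    rw [e3]; linarith
  have hDcΛ : (1 + 2 * (sectorWidth (2 * m))⁻¹) * (2 * π / L) * Λ ≤ 2 * e₀ * (2 * π / L) := by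
    rw [hw2m]
    have e1 : (1 + 2 * (π * klScale e₀ m / e₀)⁻¹) * (2 * π / L) * Λ = (2 * π / L) * (Λ + 2 * e₀ / π) := by
      have hne : klScale e₀ m ≠ 0 := by rw [← hΛdef]; exact hΛ.ne'
      rw [hΛdef]; field_simp
    rw [e1]
    have h2 : 2 * e₀ / π ≤ e₀ := by rw [div_le_iff₀ hπ]; nlinarith only [Real.pi_gt_three, he]
    have h4 := mul_le_mul_of_nonneg_left (add_le_add hΛe h2) hc.le
    linarith only [h4]
  have h2c : 2 * (2 * π / (L : ℝ)) ≤ 1 := by rw [abs_of_pos hc] at hLz; linarith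
  refine (kx1_le (cG := 4 * (d * e₀ ^ 4) + 2 * (d * e₀ ^ 2)) (g1 := d * e₀ ^ 2) (Ba := Ba) (K₂ := 4 + 4 * A) (Λ := Λ) (e₀ := e₀)
    (ρ := ρ) (τ := (4 + 2 * A) * (2 * π / L)) (h := 2 * π / L) (Dc := (1 + 2 * (sectorWidth (2 * m))⁻¹) * (2 * π / L))
    (Y := (4 + 2 * A) + (4 + 4 * A) * ((1 + 3 * π * B.smax * B.Dtmin / (4 * e₀)) / (B.Dtmin - 2 * A) * e₀ + 1))
    (by positivity) (by positivity) hB0 (by linarith) hΛ hΛe hρ0 (by positivity) hc.le (by have := sectorWidth_pos (2 * m); positivity)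
    (by have := B.smax_pos; have := B.Dtmin_pos; positivity) ?_ hDcΛ).trans (le_of_eq (by ring))
  -- `τ' ≤ hY`
  have h1 : ρ + 2 * (2 * π / L) ≤ (1 + 3 * π * B.smax * B.Dtmin / (4 * e₀)) / (B.Dtmin - 2 * A) * e₀ + 1 := by linarith
  have h2 : (4 + 4 * A) * (ρ + 2 * (2 * π / L)) * (2 * π / L) ≤
      (4 + 4 * A) * ((1 + 3 * π * B.smax * B.Dtmin / (4 * e₀)) / (B.Dtmin - 2 * A) * e₀ + 1) * (2 * π / L) := by gcongr
  linarith only [h2]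

include B hA hADt he hz hz1 hgap h3 hlo hhi hβ hρA hd1 hd2 hZ hΦ hGs in
/-- **Support count of the padded isotropic multiplier**: time window × iso cell,
`#{G̃ ≠ 0} ≤ (Λ_mβ/π + 1)·(√2L(Λ_m + (4+4A)ρ²)/(γπ) + 2)(√2L(2ρ)/π + 2)`, `γ = 2ρ_min − 4A`, `ρ` the iso cell radius.
[cite: BenfattoGiulianiMastropietro2006, §2.5 (2.57)] -/
theorem card_support_isoPadded_le (hM : klScale e₀ m * β < π * (2 * M - 3))
    [DecidablePred fun q : TorusSite 1 (2 * (2 * M)) × TorusSite 2 L => Gs q ≠ 0] :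
    (((univ : Finset (TorusSite 1 (2 * (2 * M)) × TorusSite 2 L)).filter fun q => Gs q ≠ 0).card : ℝ) ≤
      (klScale e₀ m * β / π + 1) *
        ((Real.sqrt 2 * L * ((klScale e₀ m + (4 + 4 * A) *
            ((klScale e₀ m + B.smax * B.Dtmin * (3 * sectorWidth (2 * m) / 4)) / (B.Dtmin - 2 * A)) ^ 2) / (2 * B.rhomin - 4 * A)) / π + 2) *
          (Real.sqrt 2 * L * (2 * ((klScale e₀ m + B.smax * B.Dtmin * (3 * sectorWidth (2 * m) / 4)) / (B.Dtmin - 2 * A))) / π + 2)) := by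
  classical
  haveI : NeZero (2 * (2 * M)) := ⟨by have := NeZero.ne M; omega⟩
  obtain ⟨-, -, -, -, hGv⟩ := scaleProfile_bounds he m hd1 hd2
  obtain ⟨-, hcell⟩ := isoSymbol_zone_cell B hA hADt he hz hz1 hgap hlo hhi ω hZ hΦ
  have hΛ : 0 < klScale e₀ m := by rw [klScale]; positivity
  have hL : (0 : ℝ) < L := Nat.cast_pos.2 (Nat.pos_of_ne_zero (NeZero.ne L))
  have hπ := Real.pi_pos
  have hxL : |2 * π / (L : ℝ)| * L = 2 * π := by rw [abs_of_pos (by positivity)]; field_simp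
  set ρ : ℝ := (klScale e₀ m + B.smax * B.Dtmin * (3 * sectorWidth (2 * m) / 4)) / (B.Dtmin - 2 * A) with hρdef
  have hρ0 : 0 ≤ ρ := by
    have := B.smax_pos; have := B.Dtmin_pos; have := sectorWidth_pos (2 * m)
    have : 0 < B.Dtmin - 2 * A := by linarith
    positivity
  set pF : Fin 2 → ℝ := klFermiPoint μ K (sectorCenter (2 * m) (ω : ℕ)) with hpF
  set eK : (Fin 2 → ℝ) → ℝ := fun p => frameLevel μ K (WithLp.toLp 2 p) with heK
  have hcount := card_support_sampledSymbol_le (P := 2 * (2 * M)) (L := L) hΛ hGv eK Z (pF := pF) (ρ := ρ) hz.le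
    (fun p hsq hshell hZp => hcell p hsq hshell hZp)
    Φ (fun k₀ p => hΦ k₀ p) (π * (1 - 2 * M) / β) (2 * π / β) (2 * π / L) hxL Gs
    (klIso_padded_eq_symbol hA he hz h3 hβ ω hZ hΦ hGs hM)
  have hT : (((univ : Finset (TorusSite 1 (2 * (2 * M)))).filter fun i =>
      |π * (1 - 2 * M) / β + 2 * π / β * (((i 0).val : ℕ) : ℝ)| ≤ klScale e₀ m).card : ℝ) ≤ klScale e₀ m * β / π + 1 := by
    have h := card_filter_timeWindow_le (P := 2 * (2 * M)) (a₀ := π * (1 - 2 * M) / β) (h₀ := 2 * π / β) (Λ := klScale e₀ m)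
      (by positivity) hΛ.le
    refine h.trans (le_of_eq ?_)
    field_simp
  have hlo' : a ≤ μ - A := by linarith
  have hhi' : μ + A ≤ b := by linarith
  have hγ : 0 < 2 * B.rhomin - 4 * A := by linarith
  have hX : (((univ : Finset (TorusSite 2 L)).filter fun k =>
      |eK (fun j => 2 * π / L * (((k j).valMinAbs : ℤ) : ℝ))| ≤ klScale e₀ m ∧
        ‖(fun j => 2 * π / L * (((k j).valMinAbs : ℤ) : ℝ)) - pF‖ ≤ ρ).card : ℝ) ≤
      (Real.sqrt 2 * L * ((klScale e₀ m + (4 + 4 * A) * ρ ^ 2) / (2 * B.rhomin - 4 * A)) / π + 2) *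
        (Real.sqrt 2 * L * (2 * ρ) / π + 2) := by
    refine card_filter_cell_le L (contDiff_frameBand μ K) (norm_iteratedFDeriv_two_frameBand_le hA μ)
      (pF := pF) (frameLevel_klFermiPoint B hA hlo' hhi' (sectorCenter (2 * m) (ω : ℕ))) hΛ.le hρ0 hγ
      (gradient_floor_klFermiPoint B hA hlo' hhi' (sectorCenter (2 * m) (ω : ℕ))) _ ?_
    intro k hk
    obtain ⟨h1, h2⟩ := (Finset.mem_filter.1 hk).2
    have e : (fun j => 2 * π * (((k j).valMinAbs : ℤ) : ℝ) / L) = fun j => 2 * π / L * (((k j).valMinAbs : ℤ) : ℝ) :=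
      funext fun j => by ring
    rw [e]; exact ⟨h1, h2⟩
  calc _ ≤ ((((univ : Finset (TorusSite 1 (2 * (2 * M)))).filter fun i =>
        |π * (1 - 2 * M) / β + 2 * π / β * (((i 0).val : ℕ) : ℝ)| ≤ klScale e₀ m).card *
        ((univ : Finset (TorusSite 2 L)).filter fun k =>
          |eK (fun j => 2 * π / L * (((k j).valMinAbs : ℤ) : ℝ))| ≤ klScale e₀ m ∧
            ‖(fun j => 2 * π / L * (((k j).valMinAbs : ℤ) : ℝ)) - pF‖ ≤ ρ).card : ℕ) : ℝ) := by exact_mod_cast hcount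
    _ ≤ _ := by
        push_cast
        exact mul_le_mul hT hX (Nat.cast_nonneg _) (by positivity)

end Pack

end Summit.HubbardSuperconductivity.HubbardSuperconductivity.Theorems.TorusFourierL2

end
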